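import Summits.Ventures.PercRepro.C026PFunDefs

/-!
# The vertex-type arithmetic of THEOREM S (ii) (p6, gen 16; mine-3 §27, proof steps (3)–(4))

At a lower corner every pendant vertex of the star is one of three TYPES — `E₀` (`x = 0`, `K = 0`),
`HALF` (`x = ½`, `K = 0`), `BARE` (`x = 1`, `K = 1`) — with factor triples `(3, 1, 0)`, `(5/2, 1, 1/2)`,
`(2, 2, 2)` in the closed form `(P) = ∏a − 2^{k+1}Z + 2K_A∏b − K_AZ∏c`.  With `m` vertices of type `E₀`,
`j` of type `HALF` and `n` of type `BARE`, and the probe at its own corner `K_A = K_min(Z)`, the closed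
form is `2^n·[(5/2)^j 3^m − 2^{j+m+1}Z + K_min(Z)·(2 − Z·2^{−j}·[m = 0])]`, and this file proves it
nonnegative for `Z ∈ [0, 1]` (`starTypeValue_nonneg`): the integer inequalities
`5^j − 2·4^j + 2·2^j − 1 ≥ 0`, `5^j + 3 ≥ 4·2^j`, `(5/2)^j 3^m + 2 ≥ 2^{j+m+1}` (`m ≥ 1`) and the
quadratic `4Z² − 7Z + 4 > 0` are the whole content.
-/

namespace PercRepro

/-- `5^j − 2·4^j + 2·2^j − 1 ≥ 0` for every `j` (`= (5^j − 4^j) − (2^j − 1)²`), with `4^j = (2^j)²`. -/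
theorem five_pow_ineq_a (j : ℕ) : 2 * ((2 : ℝ) ^ j * 2 ^ j) ≤ (5 : ℝ) ^ j + 2 * 2 ^ j - 1 := by
  induction j with
  | zero => norm_num
  | succ j ih =>
    rcases Nat.eq_zero_or_pos j with rfl | hj
    · norm_num
    · have h2 : (2 : ℝ) ≤ 2 ^ j := by
        calc (2 : ℝ) = 2 ^ 1 := by norm_num
          _ ≤ 2 ^ j := pow_le_pow_right₀ (by norm_num) hj
      rw [pow_succ, pow_succ]
      nlinarith [ih, h2, mul_nonneg (sub_nonneg.2 h2) (sub_nonneg.2 h2)]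

/-- `5^j + 3 ≥ 4·2^j` for every `j`. -/
theorem five_pow_ineq_b (j : ℕ) : 4 * 2 ^ j ≤ (5 : ℝ) ^ j + 3 := by
  induction j with
  | zero => norm_num
  | succ j ih =>
    have h1 : (1 : ℝ) ≤ 2 ^ j := one_le_pow₀ (by norm_num)
    rw [pow_succ, pow_succ]
    nlinarith [ih, h1]

/-- `(5/2)^j = (5/4)^j · 2^j`. -/
theorem five_half_pow_eq (j : ℕ) : ((5 : ℝ) / 2) ^ j = (5 / 4) ^ j * 2 ^ j := by
  rw [← mul_pow]; norm_num

/-- `(5/2)^j 3^m ≥ 2^{j+m}`. -/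
theorem five_half_three_pow_ge (j m : ℕ) : (2 : ℝ) ^ (j + m) ≤ (5 / 2) ^ j * 3 ^ m := by
  rw [pow_add]
  exact mul_le_mul (pow_le_pow_left₀ (by norm_num) (by norm_num) j)
    (pow_le_pow_left₀ (by norm_num) (by norm_num) m) (by positivity) (by positivity)

/-- `(5/2)^j 3^m + 2 ≥ 2^{j+m+1}` for `m ≥ 1`. -/
theorem five_half_three_pow_ineq (j m : ℕ) (hm : 1 ≤ m) :
    (2 : ℝ) ^ (j + m + 1) ≤ (5 / 2) ^ j * 3 ^ m + 2 := by
  have h2j : (0 : ℝ) < 2 ^ j := by positivity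
  have h2m : (0 : ℝ) < 2 ^ m := by positivity
  have hq : (1 : ℝ) ≤ (5 / 4) ^ j := one_le_pow₀ (by norm_num)
  rw [pow_add, pow_add, pow_one, five_half_pow_eq]
  rcases Nat.lt_or_ge m 2 with hm2 | hm2
  · -- `m = 1`: `3·(5/2)^j + 2 ≥ 4·2^j`
    have hm1 : m = 1 := by omega
    subst hm1
    rcases Nat.lt_or_ge j 2 with hj2 | hj2
    · interval_cases j <;> norm_num
    · have hq' : (25 : ℝ) / 16 ≤ (5 / 4) ^ j := by
        calc (25 : ℝ) / 16 = (5 / 4) ^ 2 := by norm_num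
          _ ≤ (5 / 4) ^ j := pow_le_pow_right₀ (by norm_num) hj2
      nlinarith [mul_le_mul_of_nonneg_right hq' h2j.le]
  · -- `m ≥ 2`: `3^m ≥ (9/4)·2^m`
    have h3 : (9 : ℝ) / 4 * 2 ^ m ≤ 3 ^ m := by
      have : (3 : ℝ) ^ m = (3 / 2) ^ m * 2 ^ m := by rw [← mul_pow]; norm_num
      rw [this]
      refine mul_le_mul_of_nonneg_right ?_ h2m.le
      calc (9 : ℝ) / 4 = (3 / 2) ^ 2 := by norm_num
        _ ≤ (3 / 2) ^ m := pow_le_pow_right₀ (by norm_num) hm2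
    nlinarith [mul_le_mul_of_nonneg_right hq h2j.le, mul_le_mul_of_nonneg_left h3 h2j.le,
      mul_le_mul_of_nonneg_right (mul_le_mul_of_nonneg_right hq h2j.le) h2m.le, mul_pos h2j h2m]

/-- The value of the star's closed form at a vertex-type assignment with `m` vertices of type
`E₀`, `j` of type `HALF`, `n` of type `BARE`, probe cells `(Z, K_A)`. -/
noncomputable def starTypeValue (n j m : ℕ) (Z KA : ℝ) : ℝ :=
  3 ^ m * (5 / 2) ^ j * 2 ^ n - 2 ^ (n + j + m + 1) * Z + 2 * KA * (1 ^ m * 1 ^ j * 2 ^ n) -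
    KA * Z * ((0 : ℝ) ^ m * (1 / 2) ^ j * 2 ^ n)

/-- The closed form factors `2^n` out. -/
theorem starTypeValue_eq (n j m : ℕ) (Z KA : ℝ) :
    starTypeValue n j m Z KA =
      2 ^ n * ((5 / 2) ^ j * 3 ^ m - 2 ^ (j + m + 1) * Z +
        KA * (2 - Z * ((0 : ℝ) ^ m * (1 / 2) ^ j))) := by
  unfold starTypeValue
  rw [show n + j + m + 1 = (j + m + 1) + n by omega, pow_add]
  ring

/-- The `m = 0` bracket: `(2 − Z)(5^j − 2·4^j Z) + (2Z − 1)(2·2^j − Z) ≥ 0` on `[0, 1]`, by the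
expansion in `u = 1 − Z` with the three nonnegative brackets. -/
theorem star_bracket_zero_nonneg (j : ℕ) {Z : ℝ} (hZ : 0 ≤ Z ∧ Z ≤ 1) :
    0 ≤ (2 - Z) * ((5 / 2) ^ j - 2 ^ (j + 1) * Z) + (2 * Z - 1) * (2 - Z * (1 / 2) ^ j) := by
  have hpos : (0 : ℝ) < 2 ^ j := by positivity
  have h5 : (2 : ℝ) ^ j * (5 / 2) ^ j = 5 ^ j := by rw [← mul_pow]; norm_num
  have hh : (2 : ℝ) ^ j * (1 / 2) ^ j = 1 := by rw [← mul_pow]; norm_num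
  have hE : (2 : ℝ) ^ j * ((2 - Z) * ((5 / 2) ^ j - 2 ^ (j + 1) * Z) +
      (2 * Z - 1) * (2 - Z * (1 / 2) ^ j)) =
      ((5 : ℝ) ^ j + 2 * 2 ^ j - 1 - 2 * (2 ^ j * 2 ^ j)) + (1 - Z) * (5 ^ j + 3 - 4 * 2 ^ j) +
        (1 - Z) ^ 2 * (2 * (2 ^ j * 2 ^ j) - 2) := by
    rw [pow_succ]
    linear_combination (2 - Z) * h5 - (2 * Z - 1) * Z * hh
  have h1 : (1 : ℝ) ≤ 2 ^ j := one_le_pow₀ (by norm_num)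
  have hnn : 0 ≤ (2 : ℝ) ^ j * ((2 - Z) * ((5 / 2) ^ j - 2 ^ (j + 1) * Z) +
      (2 * Z - 1) * (2 - Z * (1 / 2) ^ j)) := by
    rw [hE]
    have ha := five_pow_ineq_a j
    have hb := five_pow_ineq_b j
    refine add_nonneg (add_nonneg (by linarith) (mul_nonneg (by linarith) (by linarith))) ?_
    exact mul_nonneg (sq_nonneg _) (by nlinarith)
  exact (mul_nonneg_iff_of_pos_left hpos).1 hnn

/-- **The type inequality (mine-3 §27 (3)–(4))**: the star's closed form is nonnegative at every
vertex-type assignment when the probe sits at its lower corner `K_A = K_min(Z)`, `Z ∈ [0, 1]`. -/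
theorem starTypeValue_nonneg (n j m : ℕ) {Z : ℝ} (hZ : 0 ≤ Z ∧ Z ≤ 1) :
    0 ≤ starTypeValue n j m Z (kMin Z) := by
  rw [starTypeValue_eq]
  refine mul_nonneg (by positivity) ?_
  have hA : (2 : ℝ) ^ (j + m) ≤ (5 / 2) ^ j * 3 ^ m := five_half_three_pow_ge j m
  rcases le_or_gt Z (1 / 2) with hZh | hZh
  · -- zero piece of the probe: `K_A = 0`
    have hk : kMin Z = 0 := by
      unfold kMin
      rw [max_eq_left]
      apply div_nonpos_of_nonpos_of_nonneg <;> linarith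
    rw [hk, zero_mul, add_zero, pow_succ]
    nlinarith [hA, mul_nonneg (pow_nonneg (by norm_num : (0 : ℝ) ≤ 2) (j + m))
      (by linarith : 0 ≤ 1 - 2 * Z)]
  · -- tight curve of the probe: `K_A = (2Z − 1)/(2 − Z)`
    have h2Z : 0 < 2 - Z := by linarith
    have hk : kMin Z = (2 * Z - 1) / (2 - Z) := by
      unfold kMin
      rw [max_eq_right]
      apply div_nonneg <;> linarith
    rw [hk]
    have key : 0 ≤ (2 - Z) * ((5 / 2) ^ j * 3 ^ m - 2 ^ (j + m + 1) * Z) +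
        (2 * Z - 1) * (2 - Z * ((0 : ℝ) ^ m * (1 / 2) ^ j)) := by
      rcases Nat.eq_zero_or_pos m with rfl | hm
      · simpa using star_bracket_zero_nonneg j hZ
      · -- `m ≥ 1`: `(2 − Z)(A − BZ) + 2(2Z − 1) ≥ 0` with `A + 2 ≥ B`
        have h0 : ((0 : ℝ) ^ m) = 0 := zero_pow (by omega)
        rw [h0, zero_mul, mul_zero, sub_zero]
        have hAB := five_half_three_pow_ineq j m hm
        have hB : (0 : ℝ) ≤ 2 ^ (j + m + 1) := by positivity
        have hE : (2 - Z) * ((5 / 2) ^ j * 3 ^ m - 2 ^ (j + m + 1) * Z) + (2 * Z - 1) * 2 =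
            ((5 / 2) ^ j * 3 ^ m - 2 ^ (j + m + 1) + 2) + (1 - Z) * ((5 / 2) ^ j * 3 ^ m - 4) +
              2 ^ (j + m + 1) * (1 - Z) ^ 2 := by ring
        rw [hE]
        rcases le_or_gt 4 ((5 / 2 : ℝ) ^ j * 3 ^ m) with hA4 | hA4
        · exact add_nonneg (add_nonneg (by linarith) (mul_nonneg (by linarith) (by linarith)))
            (mul_nonneg hB (sq_nonneg _))
        · -- `A < 4` forces `j = 0`, `m = 1`: `4Z² − 7Z + 4 > 0`
          have hj : j = 0 := by
            by_contra hj
            have : (5 / 2 : ℝ) ^ 1 * 3 ^ 1 ≤ (5 / 2) ^ j * 3 ^ m :=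
              mul_le_mul (pow_le_pow_right₀ (by norm_num) (Nat.one_le_iff_ne_zero.2 hj))
                (pow_le_pow_right₀ (by norm_num) hm) (by positivity) (by positivity)
            norm_num at this
            linarith
          have hm1 : m = 1 := by
            by_contra hm1
            have : (5 / 2 : ℝ) ^ 0 * 3 ^ 2 ≤ (5 / 2) ^ j * 3 ^ m :=
              mul_le_mul (pow_le_pow_right₀ (by norm_num) (Nat.zero_le j))
                (pow_le_pow_right₀ (by norm_num) (by omega)) (by positivity) (by positivity)
            norm_num at this
            linarith
          subst hj hm1
          norm_num
          nlinarith [sq_nonneg (Z - 7 / 8)]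
    have : (5 / 2) ^ j * 3 ^ m - 2 ^ (j + m + 1) * Z +
        (2 * Z - 1) / (2 - Z) * (2 - Z * ((0 : ℝ) ^ m * (1 / 2) ^ j)) =
        ((2 - Z) * ((5 / 2) ^ j * 3 ^ m - 2 ^ (j + m + 1) * Z) +
          (2 * Z - 1) * (2 - Z * ((0 : ℝ) ^ m * (1 / 2) ^ j))) / (2 - Z) := by
      field_simp
    rw [this]
    exact div_nonneg key h2Z.le

end PercRepro
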